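import Mathlib
import HarnessLib
import Literature.Analysis.FluidPDE.EssCurry
import Literature.Analysis.PDE.HeatLiouville
import Literature.Analysis.PDE.SemilinearHeatHolderTools
import Summits.NavierStokesRegularity.NavierStokesRegularity.Theorems.UnthreadedDoorAntidynamoHarmonicAffine

/-!
# Route `UnthreadedDoor` / `ThreadingFlux`, crux `PoloidalLiouville` (stmt-NavierStokesRegularity-1222), antidynamo v2 skeleton
# (sha16 `4ebf5683127b`), rung `stub_singleDegreeRung`, EVEN degree — input (E1′): HARMONIC FUNCTIONS OF POLYNOMIAL GROWTH HAVE A CONSTANT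
# TOP DERIVATIVE (they are polynomials)

Support file (seat leafhand-ns-unthreadeddoor-1 g1, cell decomp-ns), `--supports stmt-NavierStokesRegularity-1222 --as helper`; theorems only.
Continuation of `…AntidynamoHarmonicAffine` (linear growth ⇒ affine).  For the even-degree rung at `l = 2` the remainder
`u = v − aPy − k∇P` of a slice grows like `r log r` before normalisation, so the degree-`2` case is needed; we prove the general statement:

* `heat_lift_of_laplacian_eq_zero` — the stationary lift `(t, x) ↦ η(x)` of a smooth harmonic `η` is caloric in the Carleman frame;
* `norm_fderiv_apply_le_of_laplacian_eq_zero` — the INTERIOR GRADIENT ESTIMATE for harmonic functions,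
  `l ‖Dη(y)[bᵢ]‖ ≤ C(E) sup_{B̄(y, l)} ‖η‖` (from the tree's parabolic estimate `exists_mul_sqrt_gradSq_le_of_heat`);
* `iteratedFDeriv_eq_of_laplacian_eq_zero_of_polynomial_growth` — a smooth `η : E → F` with `Δη = 0` and `‖η(x)‖ ≤ A (1 + ‖x‖)^N` has
  CONSTANT `N`-th derivative, `D^N η(x) = D^N η(x')` (induction on `N`: the partial derivatives `∂ᵢη` are harmonic
  (`fderiv_laplacian_apply`) of growth `N − 1` by the gradient estimate on balls of radius `1 + ‖y‖`; base case = bounded caloric Liouville).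

HONEST LABEL: an analysis input for the open even-degree rung; nothing here proves the rung, the wall, `PoloidalLiouville` (1222), or
bears on Navier–Stokes regularity. [folklore]
-/

noncomputable section

-- the summit and its single sub-problem share the name (CONVENTIONS §1)
set_option linter.dupNamespace false

open scoped Topology InnerProductSpace RealInnerProductSpace ContDiff Laplacian
open Filter Set Function Metric MeasureTheory Fin
open Literature.Analysis.FluidPDE Literature.Analysis.FluidPDE.Carleman

namespace Summit.NavierStokesRegularity.NavierStokesRegularity.Theorems.PoloidalLiouville.Antidynamo

variable {E : Type*} [NormedAddCommGroup E] [InnerProductSpace ℝ E] [FiniteDimensional ℝ E]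
  [MeasurableSpace E] [BorelSpace E]
variable {F : Type*} [NormedAddCommGroup F] [InnerProductSpace ℝ F]

omit [MeasurableSpace E] [BorelSpace E] in
/-- **The stationary lift of a harmonic function is caloric**: for smooth `η` with `Δη = 0`, `V(t, x) = η(x)` satisfies
`∂ₜV = ΔV` (both sides vanish) in the Carleman frame on all of `ℝ × E`. [folklore] -/
theorem heat_lift_of_laplacian_eq_zero {η : E → F} (hη : ContDiff ℝ (⊤ : ℕ∞) η) (hΔ : ∀ x, (Δ η) x = 0)
    (z : ℝ × E) : dt (uncurry fun _ : ℝ => η) z = lap (uncurry fun _ : ℝ => η) z := by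
  have hVs : ContDiff ℝ (⊤ : ℕ∞) (uncurry fun _ : ℝ => η) := hη.comp contDiff_snd
  have hV2 : ContDiffOn ℝ 2 (uncurry fun _ : ℝ => η) univ := (hVs.of_le (by norm_cast)).contDiffOn
  obtain ⟨t, y⟩ := z
  have hd : DifferentiableAt ℝ (uncurry fun _ : ℝ => η) (t, y) := (hVs.differentiable (by simp)).differentiableAt
  rw [dt_uncurry hd, lap_uncurry isOpen_univ (mem_univ _) hV2, Literature.Analysis.FluidPDE.timeDeriv_apply]
  simp only [deriv_const, hΔ y]

/-- **INTERIOR GRADIENT ESTIMATE FOR HARMONIC FUNCTIONS** (frame directions): there is `C = C(E) > 0` such that for every smooth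
harmonic `η : E → F`, every `y`, `l > 0` and every bound `‖η‖ ≤ B` on the closed ball `B̄(y, l)`:
`l ‖Dη(y)[bᵢ]‖ ≤ C B` for the vectors `bᵢ` of the standard orthonormal basis. [folklore] -/
theorem norm_fderiv_apply_le_of_laplacian_eq_zero :
    ∃ C : ℝ, 0 < C ∧ ∀ {η : E → F}, ContDiff ℝ (⊤ : ℕ∞) η → (∀ x, (Δ η) x = 0) →
      ∀ (y : E) {l B : ℝ}, 0 < l → (∀ w ∈ closedBall y l, ‖η w‖ ≤ B) →
      ∀ i, l * ‖fderiv ℝ η y (stdOrthonormalBasis ℝ E i)‖ ≤ C * B := by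
  obtain ⟨C, hC, hgrad⟩ := Literature.Analysis.PDE.exists_mul_sqrt_gradSq_le_of_heat (E := E) (F := F)
  refine ⟨C, hC, fun {η} hη hΔ y {l} {B} hl hB i => ?_⟩
  have hVs : ContDiff ℝ (⊤ : ℕ∞) (uncurry fun _ : ℝ => η) := hη.comp contDiff_snd
  have hV2 : ContDiffOn ℝ 2 (uncurry fun _ : ℝ => η) univ := (hVs.of_le (by norm_cast)).contDiffOn
  have h := hgrad isOpen_univ hV2 (fun z _ => heat_lift_of_laplacian_eq_zero hη hΔ z) (t₁ := 0) (x₁ := y) (l := l)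
    (B := B) hl (subset_univ _) (by rintro ⟨s, w⟩ ⟨-, hw⟩; exact hB w hw)
  -- `‖Dη(y) bᵢ‖ = ‖dx bᵢ V (0, y)‖ ≤ √gradSq V (0, y)`
  have hd : DifferentiableAt ℝ (uncurry fun _ : ℝ => η) (0, y) := (hVs.differentiable (by simp)).differentiableAt
  have h1 : ‖dx (stdOrthonormalBasis ℝ E i) (uncurry fun _ : ℝ => η) (0, y)‖ ^ 2 ≤
      gradSq (uncurry fun _ : ℝ => η) (0, y) :=
    Finset.single_le_sum (f := fun j => ‖dx (stdOrthonormalBasis ℝ E j) (uncurry fun _ : ℝ => η) (0, y)‖ ^ 2)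
      (fun j _ => sq_nonneg _) (Finset.mem_univ i)
  have h2 : ‖fderiv ℝ η y (stdOrthonormalBasis ℝ E i)‖ ≤ Real.sqrt (gradSq (uncurry fun _ : ℝ => η) (0, y)) := by
    have h' := Real.sqrt_le_sqrt h1
    rwa [Real.sqrt_sq (norm_nonneg _), dx_uncurry hd] at h'
  calc l * ‖fderiv ℝ η y (stdOrthonormalBasis ℝ E i)‖
      ≤ l * Real.sqrt (gradSq (uncurry fun _ : ℝ => η) (0, y)) := mul_le_mul_of_nonneg_left h2 hl.le
    _ ≤ C * B := h

/-- **LIOUVILLE FOR HARMONIC FUNCTIONS OF POLYNOMIAL GROWTH: the top derivative is constant.**  A smooth `η : E → F` on a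
finite-dimensional real inner product space with `Δη ≡ 0` and `‖η(x)‖ ≤ A (1 + ‖x‖)^N` has `D^N η(x) = D^N η(x')` for all `x, x'` (so `η`
is a polynomial of degree `≤ N`).  Induction on `N`: the frame derivatives `∂ᵢη` are smooth, harmonic (`fderiv_laplacian_apply`) and of
growth `N − 1` (gradient estimate on `B̄(y, 1 + ‖y‖)`); `N = 0` is the bounded case (`heat_liouville`, `γ = 0`, on the lift). [folklore] -/
theorem iteratedFDeriv_eq_of_laplacian_eq_zero_of_polynomial_growth (N : ℕ) :
    ∀ {η : E → F}, ContDiff ℝ (⊤ : ℕ∞) η → (∀ x, (Δ η) x = 0) → ∀ {A : ℝ}, (∀ x, ‖η x‖ ≤ A * (1 + ‖x‖) ^ N) →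
      ∀ x x' : E, iteratedFDeriv ℝ N η x = iteratedFDeriv ℝ N η x' := by
  induction N with
  | zero =>
    intro η hη hΔ A hA x x'
    -- bounded harmonic: the lift is a bounded caloric function on `(−∞, 1) × E`, hence constant
    have hVs : ContDiff ℝ (⊤ : ℕ∞) (uncurry fun _ : ℝ => η) := hη.comp contDiff_snd
    have key := Literature.Analysis.PDE.heat_liouville (u := uncurry fun _ : ℝ => η) (T := 1) (A := A) (γ := 0) le_rfl
      zero_lt_one ((hVs.of_le (by norm_cast)).contDiffOn) (fun z _ => heat_lift_of_laplacian_eq_zero hη hΔ z)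
      (fun z _ => by
        rw [Real.rpow_zero, mul_one]
        change ‖η z.2‖ ≤ A
        simpa using hA z.2)
      (z := ((0 : ℝ), x)) (w := ((0 : ℝ), x')) (mk_mem_prod (show (0 : ℝ) ∈ Iio 1 by norm_num) (mem_univ _))
      (mk_mem_prod (show (0 : ℝ) ∈ Iio 1 by norm_num) (mem_univ _))
    ext m
    rw [iteratedFDeriv_zero_apply, iteratedFDeriv_zero_apply]
    exact key
  | succ N ih =>
    intro η hη hΔ A hA x x'
    set b := stdOrthonormalBasis ℝ E with hb
    obtain ⟨C, hC, hgrad⟩ := norm_fderiv_apply_le_of_laplacian_eq_zero (E := E) (F := F)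
    have hA0 : 0 ≤ A := by
      have h := (norm_nonneg _).trans (hA 0)
      rw [norm_zero, add_zero, one_pow, mul_one] at h
      exact h
    -- the frame derivatives: smooth, harmonic, of growth `N`
    have hDs : ∀ i, ContDiff ℝ (⊤ : ℕ∞) (fun y => fderiv ℝ η y (b i)) := fun i =>
      (hη.fderiv_right (m := (⊤ : ℕ∞)) le_rfl).clm_apply contDiff_const
    have hDΔ : ∀ i y, (Δ fun w => fderiv ℝ η w (b i)) y = 0 := by
      intro i y
      have h3 : ContDiff ℝ 3 η := hη.of_le (by norm_cast)
      rw [← Literature.Analysis.PDE.SemilinearHeat.fderiv_laplacian_apply h3 y (b i)]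
      have h0 : (Δ η) = fun _ => (0 : F) := funext hΔ
      rw [h0, fderiv_fun_const]
      rfl
    have hDg : ∀ i y, ‖fderiv ℝ η y (b i)‖ ≤ (C * A * 2 ^ (N + 1)) * (1 + ‖y‖) ^ N := by
      intro i y
      set l : ℝ := 1 + ‖y‖ with hl
      have hl0 : 0 < l := by have := norm_nonneg y; positivity
      have hB : ∀ w ∈ closedBall y l, ‖η w‖ ≤ A * (2 * l) ^ (N + 1) := by
        intro w hw
        rw [mem_closedBall, dist_eq_norm] at hw
        have hw' : 1 + ‖w‖ ≤ 2 * l := by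
          have := norm_le_norm_add_norm_sub' w y
          linarith
        calc ‖η w‖ ≤ A * (1 + ‖w‖) ^ (N + 1) := hA w
          _ ≤ A * (2 * l) ^ (N + 1) := by gcongr
      have h := hgrad hη hΔ y hl0 hB i
      -- `l ‖∂ᵢη(y)‖ ≤ C A (2l)^{N+1} = (C A 2^{N+1} l^N) l`
      rw [show C * (A * (2 * l) ^ (N + 1)) = l * (C * A * 2 ^ (N + 1) * l ^ N) by ring] at h
      exact le_of_mul_le_mul_left h hl0
    have key : ∀ i, iteratedFDeriv ℝ N (fun y => fderiv ℝ η y (b i)) x =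
        iteratedFDeriv ℝ N (fun y => fderiv ℝ η y (b i)) x' := fun i => ih (hDs i) (hDΔ i) (hDg i) x x'
    -- assemble `D^{N+1} η` from the frame derivatives
    have hg : ContDiff ℝ (⊤ : ℕ∞) (fderiv ℝ η) := hη.fderiv_right (m := (⊤ : ℕ∞)) le_rfl
    have happly : ∀ i (y : E) (m' : Fin N → E),
        iteratedFDeriv ℝ N (fderiv ℝ η) y m' (b i) = iteratedFDeriv ℝ N (fun w => fderiv ℝ η w (b i)) y m' := by
      intro i y m'
      have h := (ContinuousLinearMap.apply ℝ F (b i)).iteratedFDeriv_comp_left (f := fderiv ℝ η)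
        (hg.contDiffAt (x := y)) (i := N) (by exact_mod_cast le_top)
      have h' := congrArg (fun M : ContinuousMultilinearMap ℝ (fun _ : Fin N => E) F => M m') h
      simp only [ContinuousLinearMap.compContinuousMultilinearMap_coe, Function.comp_apply,
        ContinuousLinearMap.apply_apply] at h'
      rw [← h']
      rfl
    ext m
    rw [iteratedFDeriv_succ_apply_right, iteratedFDeriv_succ_apply_right]
    have hT : iteratedFDeriv ℝ N (fun y => fderiv ℝ η y) x (init m) =
        iteratedFDeriv ℝ N (fun y => fderiv ℝ η y) x' (init m) := by
      refine ContinuousLinearMap.ext fun w => ?_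
      rw [← b.sum_repr w, map_sum, map_sum]
      refine Finset.sum_congr rfl fun i _ => ?_
      rw [map_smul, map_smul]
      congr 1
      change iteratedFDeriv ℝ N (fderiv ℝ η) x (init m) (b i) = iteratedFDeriv ℝ N (fderiv ℝ η) x' (init m) (b i)
      rw [happly i x, happly i x', key i]
    rw [hT]

end Summit.NavierStokesRegularity.NavierStokesRegularity.Theorems.PoloidalLiouville.Antidynamo

end
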